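import Summits.CriticalPhenomena.CardyFormulaZ2.Theorems.CardyComplexConeParafermionToSLESixFamiliesDiamondTurnCountFrame
import Literature.Probability.LatticeModels.InterfaceSLETightness
import Literature.Probability.LatticeModels.BoundaryValues
import HarnessLib

/-!
# Frame geometry of a boundary segment of a marked diamond: nearby points, the open segment, unit steps
# (line `potential-darboux-picard-diamond`, S1t `stub_freeSideTurnCount`, part 8)

Crux `ParafermionToSLESixFamilies` (stmt-CriticalPhenomena-11389), line `potential-darboux-picard-diamond`, stub
`stub_freeSideTurnCount` (S1t). Elementary real geometry in the frame of the side `k` carrying the boundary segment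
`[p, q]` (`dRot c p = dParam α β k sₚ`, `dRot c q = dParam α β k s_q`, `…DiamondTraceFrame.lean`,
`…DiamondTurnCountFrame.lean`):

* `exists_dParam_of_mem_segment` — points of `[p, q]` are `dParam α β k s`, `sₚ ≤ s ≤ s_q`, in the frame;
* `frame_of_near_segment` (registered) — a point within `d` of `[p, q]` and at distance `≥ η` from `p` and `q` has
  normal coordinate within `d` of `gam` and tangential coordinate in `[sₚ + η - 2d - gam', s_q - η + 2d - gam']`;
* `eq_of_Fk_Gk`, `mem_openSegment_of_frame` — a point ON side `k` with tangential coordinate strictly between those of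
  `p` and `q` lies in the open segment; `tangential_dichotomy_of_not_mem_openSegment` — hence a frontier point off the
  open segment and off the opposite side is tangentially before `p` or after `q`;
* `norm_meshPoint_add_cornerUnit_sub`, `abs_coord_sub_le_one_of_xiC_upC` — unit steps and blocks on the lattice.
-/

noncomputable section

namespace Summit.CriticalPhenomena.CardyFormulaZ2.Cruxes.ParafermionToSLESixFamilies.PotentialDarbouxPicardDiamond

open Set Metric Complex
open Literature.Probability Literature.Probability.LatticeModels
open Literature.Probability.RandomPlanarGeometry

variable {α β : ℝ} {c : ℂ} {k : Fin 4} {sp sq : ℝ} {p q : ℂ}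

/-! ## Points of the segment in the frame -/

/-- `dParam` commutes with line maps in the arc length. -/
theorem lineMap_dParam (α β : ℝ) (k : Fin 4) (s t θ : ℝ) :
    AffineMap.lineMap (dParam α β k s) (dParam α β k t) θ = dParam α β k (s + θ * (t - s)) := by
  rw [AffineMap.lineMap_apply_module]
  simp only [dParam, Complex.real_smul]
  push_cast
  ring

/-- **Points of `[p, q]` in the frame**: `dRot c z = dParam α β k s` with `sₚ ≤ s ≤ s_q`. -/
theorem exists_dParam_of_mem_segment (hpk : dRot c p = dParam α β k sp) (hqk : dRot c q = dParam α β k sq) (hspq : sp ≤ sq)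
    {z : ℂ} (hz : z ∈ segment ℝ p q) : ∃ s : ℝ, sp ≤ s ∧ s ≤ sq ∧ dRot c z = dParam α β k s := by
  rw [segment_eq_image_lineMap ℝ p q] at hz
  obtain ⟨θ, ⟨h0, h1⟩, rfl⟩ := hz
  refine ⟨sp + θ * (sq - sp), by nlinarith, by nlinarith, ?_⟩
  rw [dRot_lineMap, hpk, hqk, lineMap_dParam]

/-- **A point near the bulk of the segment, in the frame** (registered helper of `stub_freeSideTurnCount`): within `d` of
`[p, q]` and at distance `≥ η` from `p` and `q`, its normal coordinate is within `d` of `gam` and its tangential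
coordinate lies in `[sₚ + η - 2d - gam', s_q - η + 2d - gam']`. -/
theorem frame_of_near_segment : ∀ (α β : ℝ) (c : ℂ) (k : Fin 4) (sp sq : ℝ) (p q : ℂ), dRot c p = dParam α β k sp → dRot c q = dParam α β k sq → sp ≤ sq → ∀ (x : ℂ) (d η : ℝ), infDist x (segment ℝ p q) ≤ d → η ≤ dist x p → η ≤ dist x q → gam α β k - d ≤ Fk k (dRot c x) ∧ Fk k (dRot c x) ≤ gam α β k + d ∧ sp + η - 2 * d - gam' α β k ≤ Gk k (dRot c x) ∧ Gk k (dRot c x) ≤ sq - η + 2 * d - gam' α β k := by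
  intro α β c k sp sq p q hpk hqk hspq x d η hx hp hq
  have hcpt : IsCompact (segment ℝ p q) := by
    rw [segment_eq_image_lineMap]; exact isCompact_Icc.image AffineMap.lineMap_continuous
  obtain ⟨z, hz, hzd⟩ := hcpt.exists_infDist_eq_dist ⟨p, left_mem_segment ℝ p q⟩ x
  have hxz : dist x z ≤ d := hzd ▸ hx
  obtain ⟨s, hs1, hs2, hzs⟩ := exists_dParam_of_mem_segment hpk hqk hspq hz
  have hFz : Fk k (dRot c z) = gam α β k := by rw [hzs, Fk_dParam]
  have hGz : Gk k (dRot c z) = s - gam' α β k := by rw [hzs, Gk_dParam]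
  have hn : ‖dRot c x - dRot c z‖ ≤ d := by rw [← dist_eq_norm, dist_dRot]; exact hxz
  have hF := abs_Fk_sub_le k (dRot c x) (dRot c z)
  have hG := abs_Gk_sub_le k (dRot c x) (dRot c z)
  rw [abs_le] at hF hG
  -- the arc length of `z` is `η - d`-away from the ends
  have hzp : dist z p = |s - sp| := by rw [← dist_dRot c, hzs, hpk, dist_dParam]
  have hzq : dist z q = |s - sq| := by rw [← dist_dRot c, hzs, hqk, dist_dParam]
  have h1 : η ≤ dist x z + dist z p := hp.trans (dist_triangle _ _ _)
  have h2 : η ≤ dist x z + dist z q := hq.trans (dist_triangle _ _ _)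
  rw [hzp, abs_of_nonneg (by linarith)] at h1
  rw [hzq, abs_of_nonpos (by linarith)] at h2
  refine ⟨by linarith, by linarith, by linarith, by linarith⟩

/-! ## The open segment in the frame -/

/-- A frame point is determined by its two coordinates attached to side `k`. -/
theorem eq_of_Fk_Gk (k : Fin 4) {w w' : ℂ} (hF : Fk k w = Fk k w') (hG : Gk k w = Gk k w') : w = w' := by
  apply Complex.ext <;> fin_cases k <;> simp [Fk, Gk] at hF hG <;> linarith

/-- **A point on side `k` strictly between `p` and `q` lies in the open segment.** -/
theorem mem_openSegment_of_frame (hpk : dRot c p = dParam α β k sp) (hqk : dRot c q = dParam α β k sq)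
    {a : ℂ} (hF : Fk k (dRot c a) = gam α β k) (hG1 : sp - gam' α β k < Gk k (dRot c a))
    (hG2 : Gk k (dRot c a) < sq - gam' α β k) : a ∈ openSegment ℝ p q := by
  set θ := (Gk k (dRot c a) + gam' α β k - sp) / (sq - sp) with hθ
  have hθ0 : 0 < θ := div_pos (by linarith) (by linarith)
  have hθ1 : θ < 1 := by rw [hθ, div_lt_one (by linarith)]; linarith
  have key : a = AffineMap.lineMap p q θ := by
    apply dRot_injective c
    rw [dRot_lineMap, hpk, hqk, lineMap_dParam]
    apply eq_of_Fk_Gk k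
    · rw [hF, Fk_dParam]
    · rw [Gk_dParam, hθ, div_mul_cancel₀ _ (by linarith : sq - sp ≠ 0)]; ring
  rw [key]
  exact lineMap_mem_openSegment ℝ p q ⟨hθ0, hθ1⟩

/-- **Tangential dichotomy.** A point of the boundary of the closed frame rectangle (`|Fk| ≤ gam`, `|Gk| ≤ gam'`, one of
them an equality) which is off the open segment `(p, q) ⊆` side `k` and not on the opposite side (`-gam < Fk`) has
tangential coordinate `≤ sₚ - gam'` or `≥ s_q - gam'` (`0 ≤ sₚ`, `s_q ≤ 2 gam'`). -/
theorem tangential_dichotomy_of_not_mem_openSegment (hpk : dRot c p = dParam α β k sp)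
    (hqk : dRot c q = dParam α β k sq) (hsp : 0 ≤ sp) (hsq : sq ≤ 2 * gam' α β k) {a : ℂ}
    (hbd : |Fk k (dRot c a)| = gam α β k ∨ |Gk k (dRot c a)| = gam' α β k) (hopp : -gam α β k < Fk k (dRot c a))
    (hseg : a ∉ openSegment ℝ p q) : Gk k (dRot c a) ≤ sp - gam' α β k ∨ sq - gam' α β k ≤ Gk k (dRot c a) := by
  rcases hbd with h | h
  · have hF : Fk k (dRot c a) = gam α β k := by
      rcases (abs_eq ((abs_nonneg _).trans_eq h)).1 h with h' | h' <;> linarith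
    by_contra hc
    rw [not_or, not_le, not_le] at hc
    exact hseg (mem_openSegment_of_frame hpk hqk hF hc.1 hc.2)
  · have h0 : 0 ≤ gam' α β k := (abs_nonneg _).trans_eq h
    rcases (abs_eq h0).1 h with h' | h'
    · right; linarith
    · left; linarith

/-! ## Unit steps and blocks on the lattice -/

/-- A lattice step moves the mesh point by `δ`. -/
theorem norm_meshPoint_add_cornerUnit_sub {δ : ℝ} (hδ : 0 ≤ δ) (v : Site 2) (m : Fin 4) :
    ‖meshPoint δ (v + cornerUnit m) - meshPoint δ v‖ = δ := by
  rw [meshPoint_add, add_sub_cancel_left, meshPoint, norm_mul, toComplex_cornerUnit, norm_pow, Complex.norm_I, one_pow,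
    mul_one, Complex.norm_real, Real.norm_eq_abs, abs_of_nonneg hδ]

/-- Two lattice steps move the mesh point by at most `2δ`. -/
theorem norm_meshPoint_add_add_sub_le {δ : ℝ} (hδ : 0 ≤ δ) (v : Site 2) (m m' : Fin 4) :
    ‖meshPoint δ (v + cornerUnit m + cornerUnit m') - meshPoint δ v‖ ≤ 2 * δ := by
  have h1 := norm_meshPoint_add_cornerUnit_sub hδ (v + cornerUnit m) m'
  have h2 := norm_meshPoint_add_cornerUnit_sub hδ v m
  have := norm_sub_le_norm_sub_add_norm_sub (meshPoint δ (v + cornerUnit m + cornerUnit m')) (meshPoint δ (v + cornerUnit m))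
    (meshPoint δ v)
  linarith

/-- **Blocks in the frame coordinates**: `|Δ xiC| ≤ 1` and `|Δ upC| ≤ 1` give `|Δ vᵢ| ≤ 1`. -/
theorem abs_coord_sub_le_one_of_xiC_upC {k : Fin 4} {v w : Site 2} (h1 : |xiC k w - xiC k v| ≤ 1)
    (h2 : |upC k w - upC k v| ≤ 1) (i : Fin 2) : |w i - v i| ≤ 1 := by
  rw [abs_le] at h1 h2 ⊢
  fin_cases k <;> fin_cases i <;> simp [xiC, upC] at h1 h2 ⊢ <;> omega

/-- A mesh point moves by at most `2δ` within a block of frame radius one. -/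
theorem norm_meshPoint_sub_le_of_xiC_upC {δ : ℝ} (hδ : 0 ≤ δ) {k : Fin 4} {v w : Site 2} (h1 : |xiC k w - xiC k v| ≤ 1)
    (h2 : |upC k w - upC k v| ≤ 1) : ‖meshPoint δ w - meshPoint δ v‖ ≤ 2 * δ := by
  have h := norm_meshPoint_sub_le_of_block hδ (abs_coord_sub_le_one_of_xiC_upC h1 h2)
  have hs : Real.sqrt 2 ≤ 2 := by
    rw [show (2:ℝ) = Real.sqrt 4 by rw [show (4:ℝ) = 2 ^ 2 by norm_num, Real.sqrt_sq (by norm_num)]]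
    exact Real.sqrt_le_sqrt (by norm_num)
  nlinarith

end Summit.CriticalPhenomena.CardyFormulaZ2.Cruxes.ParafermionToSLESixFamilies.PotentialDarbouxPicardDiamond

end
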